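import Literature.Barriers.RiemannHypothesis.JensenPolynomialsChasse
import Literature.NumberTheory.LFunctions.JensenPolyaProofs
import Literature.NumberTheory.LFunctions.EquivalentsProofs
import Mathlib.Analysis.SpecialFunctions.Trigonometric.Series
import Mathlib.Analysis.SpecialFunctions.Trigonometric.Complex
import Mathlib.Analysis.Analytic.OfScalars
import Mathlib.Analysis.Complex.Liouville
import HarnessLib

/-!
# Barrier `JensenPolynomials`, `√`-normalisation: large-shift hyperbolicity of `J^{d,n}_γ` is blind
# to the reality of the zeros of `Ξ(√z)` (Farmer 2022, §§3–4) — witness `cosh 2 + cosh √w`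

Barrier catalogue `Literature/Barriers/RiemannHypothesis/` (D-0021), sibling file of
`JensenPolynomials.lean` (entry `JensenPolynomials`, Farmer 2022). That file PROVES the barrier in
Farmer's *classical* normalisation — Jensen polynomials `J^{d,n}_{f,cl}` of the derivatives `f⁽ⁿ⁾`
of a real entire `f` of order `< 2` with zeros in a strip, witness `quadExp z = (1 + z²)eᶻ`. But the
polynomials of Pólya's criterion and of Griffin–Ono–Rolen–Zagier are the *even* ones: "the even
Jensen polynomial of `f(z)` is the classical Jensen polynomial of `f(√z)`. In the case of the Riemann
`ξ`-function, the Riemann hypothesis is equivalent to the assertion that `ξ(½ + √z)` has zeros only on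
the negative real axis" (Farmer 2022, §3). In the tree this is literally how Pólya's criterion is
proved (`Literature/NumberTheory/LFunctions/JensenPolyaProofs.lean`): with
`G = Literature.NumberTheory.LFunctions.xiSq`, `G(w²) = ξ(½ + w)`, an entire function of order `≤ 7/8`,
one has `γ(k) = 8 Re G⁽ᵏ⁾(0)`, `RH ↔ (∀ w, G w = 0 → Im w = 0)` and
`RH ↔ ∀ d n, J^{d,n}_γ hyperbolic`, via the genus-zero Laguerre–Pólya theorem
`Literature.Analysis.Complex.PolyaSchur.splits_jensenPoly_taylor_of_zeros_real`. The sequence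
`quadExpCoeff` of the base file is NOT of this kind (its generating function `(1 + w²)eʷ` has order
`1`, not `< 1`), so the base theorem leaves open whether, inside the genus-zero class of `xiSq` with its
extra structure (positive coefficients `γ(n) > 0`, zeros `(ρ - ½)²` confined to the image of the
critical strip), large-shift hyperbolicity could still propagate to shift `0`. This file closes that
gap.

## The witness and the theorem (`JensenPolynomialsSqrt`, proved as `JensenPolynomialsSqrt_holds`)

`G(w) = cosh 2 + cosh √w = (cosh 2 + 1) + Σ_{k ≥ 1} wᵏ/(2k)!` (`coshSqrtShift`; Farmer's even
function is `f(z) = G(-z²) = cos z + cosh 2`, a `cos` with no real zeros — compare his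
`X_{10} = cos z · (moved zeros)`, §4). Proved here:

* `G` is entire of order `< 1` (`‖G w‖ ≤ (cosh 2 + 1) e^{√‖w‖}`), with real, positive Taylor
  coefficients `cosh 2 + 1, 1/2!, 2!/4!, 3!/6!, …` (`taylorCoeffSeq_coshSqrtShift`);
* `G' (w) = sinh √w/(2√w)` is entire of order `< 1` with `G'(0) = ½` and ONLY REAL ZEROS `-k²π²`
  (`im_eq_zero_of_deriv_coshSqrt_eq_zero`, from `2u G'(u²) = sinh u`), i.e. `G'` is a genus-zero
  Laguerre–Pólya function; hence (tree theorem `splits_jensenPoly_taylor_of_zeros_real`) **every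
  `J^{d,n}` of `G` with `n ≥ 1` is hyperbolic**, for every `d` (`splits_jensenPoly_coshSqrtShift`) —
  the strongest possible form of "hyperbolic for all large shifts", uniformly `N(d) = 1`;
* the zeros of `G` are `w = (±2 + (2m+1)πi)²`: **not one of them is real**
  (`im_ne_zero_of_coshSqrtShift_eq_zero`), there are infinitely many
  (`coshSqrtShift_zeros_infinite`), and all are squares of points of the two vertical lines
  `|Re u| = 2` (`abs_re_eq_two_of_coshSqrtShift_eq_zero`) — for `xiSq` the zeros are squares of
  points of the strip `|Re u| < ½` and RH says they are squares of points of the line `Re u = 0`;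
* **no `J^{d,0}` of `G` with `d ≥ 2` is hyperbolic** (`not_splits_jensenPoly_coshSqrtShift_zero`):
  Newton's inequality `a₀a₂ ≤ a₁²` for hyperbolic `J^{d,0}` (`mul_le_sq_of_splits_jensenPoly`, by
  reflection, `d - 2` derivatives and a discriminant, from the tree's `PolyaSchur.splits_reflect`,
  `PolyaSchur.splits_iterate_derivative`) fails: `(1/2)² < (cosh 2 + 1)/12` as `cosh 2 > 2`.

For comparison `xiSq_mem_witnessClass` records that `xiSq` has, unconditionally and as theorems of
the tree, every property in the list (order `< 1`; `γ(n) > 0`, `xiTaylorCoeff_pos_holds`; zeros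
`(ρ - ½)²` with `|Re(ρ - ½)| < ½`; `EventuallyHyperbolic`, GORZ Thm. 1 = `gorz_eventually_holds`), that
RH is the reality of its zeros and Pólya's criterion is `AllHyperbolic (taylorCoeffSeq xiSq)`
(`polya_jensen_holds`). So no inference from the shift-`≥ 1` Jensen polynomials plus that structure
to RH can be valid. (The `J^{d,n}`, `n ≥ 1`, do not even involve `γ(0)`: for `G_C = C + cosh √w`,
`C` real, the constant alone decides — all zeros of `G_C` are real iff `-1 ≤ C ≤ 1`, and for `C > 1`
not a single zero is real.)

A remark on Farmer's text (§4): for his `X_{10}` he asserts real-rootedness of the even Jensen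
polynomials "for all even `n ≥ 2`"; the mechanism formalised here gives it for all `n ≥ 1`: if `f` is
even of order `< 2` and `f'` has only real zeros, then `(f ∘ √)' = f'(√w)/(2√w)` is a genus-zero
function with only real zeros.

## References

* [Farmer2022] D. W. Farmer, *Jensen polynomials are not a plausible route to proving the Riemann
  hypothesis*, Adv. Math. 411 (2022), 108781 = arXiv:2008.07206 (read: §2 p. 4, §3 p. 5 "the even
  Jensen polynomial of `f(z)` is the classical Jensen polynomial of `f(√z)`", §4 p. 6 `X_{10}`).
* [GORZPNAS2019] M. Griffin, K. Ono, L. Rolen, D. Zagier, *Jensen polynomials for the Riemann zeta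
  function and other sequences*, PNAS 116 (2019), 11103–11110 = arXiv:1902.07321 (read: §1 pp. 1–3,
  eq. (1), Thms. 1–3, footnote on Chasse).
* [CravenCsordas1989] T. Craven, G. Csordas, Pacific J. Math. 136 (1989), §1 (i) (the genus-zero
  Laguerre–Pólya theorem, as proved in `JensenPolynomialHyperbolicity.lean`).
* [GriffinEtAl2022] M. Griffin, K. Ono, L. Rolen, J. Thorner, Z. Tripp, I. Wagner, *Jensen polynomials
  for the Riemann xi-function*, Adv. Math. 397 (2022), 108186 = arXiv:1910.01227 (read: §1 p. 3,
  Thms. 1.1–1.2, Cor. 1.3: `n ≥ c e^{d/2}`; `d ≤ 9.36·10^20` for all `n` from Platt's `RH₀(3.06·10^10)`).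
* [Holland2026] J. Holland, *A new hyperbolicity wedge and a joint semicircle limit for Jensen
  polynomials of Riemann's ξ-function*, arXiv:2608.08682 (read: pp. 1–2, Thm. 1.1:
  `n³ log²(n+2) ≥ K d⁵ ⟹ J^{d,n}` hyperbolic).
* [Osullivan2021] C. O'Sullivan, *Zeros of Jensen polynomials and asymptotics for the Riemann xi
  function*, Res. Math. Sci. 8 (2021) = arXiv:2007.13582 (abstract; the implication
  `J^{d,n}` hyperbolic ⟹ `P^{d,n}` hyperbolic is quoted from Farmer 2022, §4.1).
* [Duran2024] A. J. Durán, *Brenke polynomials with real zeros and the Riemann Hypothesis*,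
  arXiv:2405.18940 (abstract).

## Design notes

* `coshSqrt` is defined as the sum of the power series `Σ wᵏ/(2k)!`
  (`FormalMultilinearSeries.ofScalarsSum`, infinite radius), exactly as the tree's `xiSq`; the
  identity `coshSqrt (u²) = cosh u` (`Complex.hasSum_cosh`) carries all the trigonometry, and
  `G' = deriv coshSqrt` is handled through `2u · G'(u²) = sinh u` (chain rule) and Cauchy's estimate,
  without a second power series.
* Hyperbolic = `Polynomial.Splits` over `ℝ`, sequences `taylorCoeffSeq G k = Re G⁽ᵏ⁾(0)` and the
  predicates `EventuallyHyperbolic` / `AllHyperbolic` exactly as in the base file; for `xiSq` these are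
  `gorz_eventually` / `JensenPolyaCriterion` (`eventuallyHyperbolic_taylorCoeffSeq_xiSq_iff`,
  `allHyperbolic_taylorCoeffSeq_xiSq_iff`; `taylorCoeffSeq xiSq = γ/8`).
-/

noncomputable section

open Complex Polynomial Filter Topology
open scoped Nat

namespace Literature.Barriers.RiemannHypothesis

open Literature.Analysis.TotalPositivity (IsEntireOfOrderLtOne)
open Literature.NumberTheory.LFunctions (jensenPoly xiSq xiTaylorCoeff exists_sq_eq)

/-! ## The entire function `coshSqrt w = Σ w^k/(2k)! = cosh √w` -/

/-- Power-series coefficients `1/(2k)!` of `cosh √w`. [folklore] -/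
def coshSqrtCoeff (k : ℕ) : ℂ := (((2 * k)! : ℕ) : ℂ)⁻¹

/-- `coshSqrt w = Σ_k w^k/(2k)!`, the entire function of order `1/2` with `coshSqrt (u²) = cosh u`.
[folklore] -/
def coshSqrt : ℂ → ℂ := FormalMultilinearSeries.ofScalarsSum (E := ℂ) coshSqrtCoeff

/-- `‖1/(2k)!‖ = 1/(2k)!`. [folklore] -/
theorem norm_coshSqrtCoeff (k : ℕ) : ‖coshSqrtCoeff k‖ = (((2 * k)! : ℕ) : ℝ)⁻¹ := by
  rw [coshSqrtCoeff, norm_inv, Complex.norm_natCast]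

/-- `Σ rᵏ/(2k)! = cosh √r` for `r ≥ 0`. [folklore] -/
theorem hasSum_pow_div_factorial_two_mul {r : ℝ} (hr : 0 ≤ r) :
    HasSum (fun k : ℕ ↦ r ^ k / (((2 * k)! : ℕ) : ℝ)) (Real.cosh (Real.sqrt r)) := by
  have h := Real.hasSum_cosh (Real.sqrt r)
  refine h.congr_fun fun k ↦ ?_
  rw [pow_mul, Real.sq_sqrt hr]

/-- The power series of `coshSqrt` has infinite radius of convergence. [folklore] -/
theorem coshSqrt_radius_eq_top :
    (FormalMultilinearSeries.ofScalars ℂ coshSqrtCoeff).radius = ⊤ := by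
  refine FormalMultilinearSeries.radius_eq_top_of_summable_norm _ fun r ↦ ?_
  refine (hasSum_pow_div_factorial_two_mul r.coe_nonneg).summable.congr fun k ↦ ?_
  rw [FormalMultilinearSeries.ofScalars_norm, norm_coshSqrtCoeff, div_eq_inv_mul]

/-- `coshSqrt` is the sum of its power series on all of `ℂ`. [folklore] -/
theorem hasFPowerSeriesOnBall_coshSqrt :
    HasFPowerSeriesOnBall coshSqrt (FormalMultilinearSeries.ofScalars ℂ coshSqrtCoeff) 0 ⊤ := by
  have h := (FormalMultilinearSeries.ofScalars ℂ coshSqrtCoeff).hasFPowerSeriesOnBall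
    (by rw [coshSqrt_radius_eq_top]; exact ENNReal.zero_lt_top)
  rw [coshSqrt_radius_eq_top] at h
  exact h

/-- `coshSqrt` is entire. [folklore] -/
theorem differentiable_coshSqrt : Differentiable ℂ coshSqrt := by
  intro z
  have hz : z ∈ Metric.eball (0 : ℂ) ⊤ := by
    rw [Metric.mem_eball]; exact edist_lt_top z 0
  exact (hasFPowerSeriesOnBall_coshSqrt.analyticAt_of_mem hz).differentiableAt

/-- `coshSqrt w = Σ (2k)!⁻¹ wᵏ`. [folklore] -/
theorem coshSqrt_eq_tsum (w : ℂ) : coshSqrt w = ∑' k : ℕ, coshSqrtCoeff k * w ^ k := by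
  rw [coshSqrt, FormalMultilinearSeries.ofScalars_sum_eq]
  rfl

/-- `coshSqrt (u²) = cosh u`. [folklore] -/
theorem coshSqrt_sq (u : ℂ) : coshSqrt (u ^ 2) = Complex.cosh u := by
  rw [coshSqrt_eq_tsum, ← (Complex.hasSum_cosh u).tsum_eq]
  refine tsum_congr fun k ↦ ?_
  rw [coshSqrtCoeff, ← pow_mul, div_eq_inv_mul]

/-- `coshSqrt 0 = 1`. [folklore] -/
theorem coshSqrt_zero : coshSqrt 0 = 1 := by
  simpa using coshSqrt_sq 0

/-- Taylor coefficients: `coshSqrt⁽ᵏ⁾(0) = k!/(2k)!`. [folklore] -/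
theorem iteratedDeriv_coshSqrt_zero (k : ℕ) :
    iteratedDeriv k coshSqrt 0 = (k ! : ℂ) * ((((2 * k)! : ℕ) : ℂ))⁻¹ := by
  have h := hasFPowerSeriesOnBall_coshSqrt.factorial_smul 1 k
  rw [iteratedDeriv_eq_iteratedFDeriv, ← h, FormalMultilinearSeries.ofScalars_apply_eq]
  simp [nsmul_eq_mul, coshSqrtCoeff]

/-- Growth: `‖coshSqrt w‖ ≤ cosh √‖w‖ ≤ exp (‖w‖^{1/2})` (order `1/2`). [folklore] -/
theorem norm_coshSqrt_le (w : ℂ) : ‖coshSqrt w‖ ≤ Real.exp (‖w‖ ^ (1 / 2 : ℝ)) := by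
  have hs := hasSum_pow_div_factorial_two_mul (norm_nonneg w)
  have hterm : ∀ k : ℕ, ‖coshSqrtCoeff k * w ^ k‖ = ‖w‖ ^ k / (((2 * k)! : ℕ) : ℝ) := fun k ↦ by
    rw [norm_mul, norm_pow, norm_coshSqrtCoeff, div_eq_inv_mul]
  have hsum : Summable fun k : ℕ ↦ ‖coshSqrtCoeff k * w ^ k‖ := by
    simpa only [hterm] using hs.summable
  calc ‖coshSqrt w‖ = ‖∑' k : ℕ, coshSqrtCoeff k * w ^ k‖ := by rw [coshSqrt_eq_tsum]
    _ ≤ ∑' k : ℕ, ‖coshSqrtCoeff k * w ^ k‖ := norm_tsum_le_tsum_norm hsum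
    _ = Real.cosh (Real.sqrt ‖w‖) := by simp only [hterm]; exact hs.tsum_eq
    _ ≤ Real.exp (Real.sqrt ‖w‖) := by
        -- `cosh x ≤ eˣ` for `x = √‖w‖ ≥ 0`
        rw [Real.cosh_eq]
        have : Real.exp (-Real.sqrt ‖w‖) ≤ Real.exp (Real.sqrt ‖w‖) :=
          Real.exp_le_exp.2 (by linarith [Real.sqrt_nonneg ‖w‖])
        linarith
    _ = Real.exp (‖w‖ ^ (1 / 2 : ℝ)) := by rw [Real.sqrt_eq_rpow]

/-- `coshSqrt` is entire of order `< 1` (`ρ = 1/2`, `C = 1`). [folklore] -/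
theorem isEntireOfOrderLtOne_coshSqrt : IsEntireOfOrderLtOne coshSqrt :=
  ⟨differentiable_coshSqrt, 1 / 2, 1, by norm_num, fun z ↦ by simpa using norm_coshSqrt_le z⟩

/-! ## The derivative `coshSqrt' (w) = sinh √w / (2√w)` is in the genus-zero Laguerre–Pólya class -/

/-- Chain rule: `d/du coshSqrt (u²) = coshSqrt'(u²) · 2u`. [folklore] -/
theorem hasDerivAt_coshSqrt_sq (u : ℂ) :
    HasDerivAt (fun v : ℂ ↦ coshSqrt (v ^ 2)) (deriv coshSqrt (u ^ 2) * (2 * u)) u := by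
  have h1 : HasDerivAt coshSqrt (deriv coshSqrt (u ^ 2)) (u ^ 2) :=
    (differentiable_coshSqrt _).hasDerivAt
  have h2 : HasDerivAt (fun v : ℂ ↦ v ^ 2) (2 * u) u := by simpa using hasDerivAt_pow 2 u
  exact h1.comp u h2

/-- `2u · coshSqrt'(u²) = sinh u` (differentiate `coshSqrt (u²) = cosh u`). [folklore] -/
theorem deriv_coshSqrt_sq_mul (u : ℂ) : deriv coshSqrt (u ^ 2) * (2 * u) = Complex.sinh u := by
  have h' : HasDerivAt (fun v : ℂ ↦ coshSqrt (v ^ 2)) (Complex.sinh u) u := by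
    have : (fun v : ℂ ↦ coshSqrt (v ^ 2)) = Complex.cosh := funext coshSqrt_sq
    rw [this]
    exact Complex.hasDerivAt_cosh u
  exact (hasDerivAt_coshSqrt_sq u).unique h'

/-- `coshSqrt'(0) = 1/2`. [folklore] -/
theorem deriv_coshSqrt_zero : deriv coshSqrt 0 = 1 / 2 := by
  have h := iteratedDeriv_coshSqrt_zero 1
  rw [iteratedDeriv_one] at h
  rw [h]
  norm_num [Nat.factorial]

/-- `coshSqrt'` is entire. [folklore] -/
theorem differentiable_deriv_coshSqrt : Differentiable ℂ (deriv coshSqrt) := fun z ↦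
  ((differentiable_coshSqrt.analyticAt z).deriv).differentiableAt

/-- Cauchy's estimate on circles of radius `1`: `‖coshSqrt' z‖ ≤ e · exp (‖z‖^{1/2})`. [folklore] -/
theorem norm_deriv_coshSqrt_le (z : ℂ) :
    ‖deriv coshSqrt z‖ ≤ Real.exp 1 * Real.exp (‖z‖ ^ (1 / 2 : ℝ)) := by
  have h := Complex.norm_deriv_le_of_forall_mem_sphere_norm_le (f := coshSqrt) (c := z)
    (R := 1) (C := Real.exp 1 * Real.exp (‖z‖ ^ (1 / 2 : ℝ))) one_pos
    differentiable_coshSqrt.diffContOnCl fun w hw ↦ ?_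
  · simpa using h
  · rw [mem_sphere_iff_norm] at hw
    have hwz : ‖w‖ ≤ ‖z‖ + 1 := by
      calc ‖w‖ = ‖(w - z) + z‖ := by rw [sub_add_cancel]
        _ ≤ ‖w - z‖ + ‖z‖ := norm_add_le _ _
        _ = ‖z‖ + 1 := by rw [hw, add_comm]
    calc ‖coshSqrt w‖ ≤ Real.exp (‖w‖ ^ (1 / 2 : ℝ)) := norm_coshSqrt_le w
      _ ≤ Real.exp ((‖z‖ + 1) ^ (1 / 2 : ℝ)) := by gcongr
      _ ≤ Real.exp (1 + ‖z‖ ^ (1 / 2 : ℝ)) := by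
          -- `√(r + 1) ≤ √r + 1` for `r = ‖z‖`
          rw [Real.exp_le_exp, ← Real.sqrt_eq_rpow, ← Real.sqrt_eq_rpow, add_comm 1,
            Real.sqrt_le_left (by positivity)]
          nlinarith [Real.sq_sqrt (norm_nonneg z), Real.sqrt_nonneg ‖z‖]
      _ = Real.exp 1 * Real.exp (‖z‖ ^ (1 / 2 : ℝ)) := by rw [Real.exp_add]

/-- `coshSqrt'` is entire of order `< 1` (`ρ = 1/2`). [folklore] -/
theorem isEntireOfOrderLtOne_deriv_coshSqrt : IsEntireOfOrderLtOne (deriv coshSqrt) :=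
  ⟨differentiable_deriv_coshSqrt, 1 / 2, Real.exp 1, by norm_num, norm_deriv_coshSqrt_le⟩

/-- **The zeros of `coshSqrt'` are real** (they are `-k²π²`, `k ≥ 1`: `2u coshSqrt'(u²) = sinh u`).
[folklore] -/
theorem im_eq_zero_of_deriv_coshSqrt_eq_zero {w : ℂ} (hw : deriv coshSqrt w = 0) : w.im = 0 := by
  obtain ⟨u, rfl⟩ := exists_sq_eq w
  have hs : Complex.sinh u = 0 := by rw [← deriv_coshSqrt_sq_mul, hw, zero_mul]
  have hsin : Complex.sin (u * I) = 0 := by rw [Complex.sin_mul_I, hs, zero_mul]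
  obtain ⟨k, hk⟩ := Complex.sin_eq_zero_iff.1 hsin
  have hu : u = -(k * Real.pi * I) := by
    have : u = u * I * (-I) := by rw [mul_assoc, mul_neg, I_mul_I, neg_neg, mul_one]
    rw [this, hk]
    ring
  rw [hu]
  simp [sq]

/-- Taylor coefficients of `coshSqrt'` are those of `coshSqrt`, shifted by one. [folklore] -/
theorem iteratedDeriv_deriv_coshSqrt_zero (k : ℕ) :
    iteratedDeriv k (deriv coshSqrt) 0 = iteratedDeriv (k + 1) coshSqrt 0 := by
  rw [iteratedDeriv_succ']

/-- Hence every Jensen polynomial of the Taylor sequence of `coshSqrt'` is hyperbolic (the tree's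
genus-zero Laguerre–Pólya theorem `PolyaSchur.splits_jensenPoly_taylor_of_zeros_real`).
[cite: CravenCsordas1989, §1 (i)] -/
theorem splits_jensenPoly_deriv_coshSqrt (d n : ℕ) :
    (jensenPoly (fun k ↦ (iteratedDeriv k (deriv coshSqrt) 0).re) d n).Splits :=
  Literature.Analysis.Complex.PolyaSchur.splits_jensenPoly_taylor_of_zeros_real
    isEntireOfOrderLtOne_deriv_coshSqrt (by norm_num [deriv_coshSqrt_zero])
    (by norm_num [deriv_coshSqrt_zero]) (fun _ hz ↦ im_eq_zero_of_deriv_coshSqrt_eq_zero hz) d n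

/-! ## Newton's first inequality for hyperbolic Jensen polynomials at shift `0` -/

/-- The `d`-th derivative of the reflection of `J^{d+2,0}_a` is the quadratic
`((d+2)!/2) · (a₀ X² + 2a₁ X + a₂)`: its three coefficients. [folklore] -/
theorem coeff_iterate_derivative_reflect_jensenPoly (a : ℕ → ℝ) (d : ℕ) :
    (derivative^[d] (reflect (d + 2) (jensenPoly a (d + 2) 0))).coeff 0 =
        ((d + 2)! : ℝ) / 2 * a 2 ∧
      (derivative^[d] (reflect (d + 2) (jensenPoly a (d + 2) 0))).coeff 1 =
        ((d + 2)! : ℝ) / 2 * (2 * a 1) ∧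
      (derivative^[d] (reflect (d + 2) (jensenPoly a (d + 2) 0))).coeff 2 =
        ((d + 2)! : ℝ) / 2 * a 0 := by
  have hfac : ((d + 2)! : ℝ) = (d + 2) * (d + 1) * d ! := by
    rw [Nat.factorial_succ, Nat.factorial_succ]; push_cast; ring
  have hc2 : ((d + 2).choose 2 : ℝ) = (d + 2) * (d + 1) / 2 := by
    rw [Nat.cast_choose_two]; push_cast; ring
  refine ⟨?_, ?_, ?_⟩
  · rw [coeff_iterate_derivative, coeff_reflect, zero_add, revAt_le (by omega), Nat.descFactorial_self,
      coeff_jensenPoly, show d + 2 - d = 2 by omega, nsmul_eq_mul, hc2, hfac]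
    ring
  · rw [coeff_iterate_derivative, coeff_reflect, revAt_le (by omega), coeff_jensenPoly,
      show d + 2 - (1 + d) = 1 by omega, Nat.descFactorial_eq_factorial_mul_choose, add_comm 1 d,
      Nat.choose_succ_self_right, Nat.choose_one_right, nsmul_eq_mul, hfac]
    push_cast
    ring
  · rw [coeff_iterate_derivative, coeff_reflect, revAt_le (by omega), coeff_jensenPoly,
      show d + 2 - (2 + d) = 0 by omega, Nat.descFactorial_eq_factorial_mul_choose, add_comm 2 d,
      Nat.choose_symm_add, Nat.choose_zero_right, nsmul_eq_mul, hfac]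
    push_cast
    rw [hc2]
    ring

/-- **Newton's inequality.** If `J^{d+2,0}_a` is hyperbolic and `a₀ ≠ 0` then `a₀ a₂ ≤ a₁²`:
reflect (`PolyaSchur.splits_reflect`), differentiate `d` times (`PolyaSchur.splits_iterate_derivative`,
Rolle) and read off the discriminant of the resulting quadratic `((d+2)!/2)(a₀X² + 2a₁X + a₂)`.
[folklore] -/
theorem mul_le_sq_of_splits_jensenPoly {a : ℕ → ℝ} {d : ℕ} (ha : a 0 ≠ 0)
    (h : (jensenPoly a (d + 2) 0).Splits) : a 0 * a 2 ≤ a 1 ^ 2 := by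
  set J := jensenPoly a (d + 2) 0 with hJ
  have hJdeg : J.natDegree ≤ d + 2 := natDegree_jensenPoly_le _ _ _
  set R := reflect (d + 2) J with hR
  have hRs : R.Splits := Literature.Analysis.Complex.PolyaSchur.splits_reflect h hJdeg
  have hRdeg : R.natDegree ≤ d + 2 := natDegree_reflect_le.trans (max_le le_rfl hJdeg)
  set Q := derivative^[d] R with hQ
  have hQs : Q.Splits := Literature.Analysis.Complex.PolyaSchur.splits_iterate_derivative hRs d
  have hQdeg : Q.natDegree ≤ 2 := (natDegree_iterate_derivative R d).trans (by omega)
  obtain ⟨hQ0, hQ1, hQ2⟩ := coeff_iterate_derivative_reflect_jensenPoly a d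
  rw [← hJ, ← hR, ← hQ] at hQ0 hQ1 hQ2
  have hκ : (0 : ℝ) < ((d + 2)! : ℝ) / 2 := by positivity
  have hQ2ne : Q.coeff 2 ≠ 0 := by rw [hQ2]; exact mul_ne_zero hκ.ne' ha
  have hdeg : Q.degree ≠ 0 := fun h0 ↦ by
    have h2 : (2 : WithBot ℕ) ≤ Q.degree := le_degree_of_ne_zero hQ2ne
    rw [h0] at h2
    exact absurd h2 (by decide)
  obtain ⟨x, hx⟩ := hQs.exists_eval_eq_zero hdeg
  rw [eval_eq_sum_range' (lt_of_le_of_lt hQdeg (by norm_num : 2 < 3)), Finset.sum_range_succ,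
    Finset.sum_range_succ, Finset.sum_range_one, hQ0, hQ1, hQ2] at hx
  have hq : a 0 * (x * x) + 2 * a 1 * x + a 2 = 0 := by
    have : ((d + 2)! : ℝ) / 2 * (a 0 * (x * x) + 2 * a 1 * x + a 2) = 0 := by
      rw [← hx]; ring
    rcases mul_eq_zero.1 this with h1 | h1
    · exact absurd h1 hκ.ne'
    · exact h1
  have hdisc := discrim_eq_sq_of_quadratic_eq_zero hq
  have h0 : 0 ≤ discrim (a 0) (2 * a 1) (a 2) := by rw [hdisc]; positivity
  rw [discrim] at h0
  nlinarith

/-- Contrapositive: `a₁² < a₀a₂` (`a₀ ≠ 0`) makes every `J^{d,0}_a`, `d ≥ 2`, non-hyperbolic. [folklore] -/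
theorem not_splits_jensenPoly_of_sq_lt {a : ℕ → ℝ} (ha : a 0 ≠ 0) (hlt : a 1 ^ 2 < a 0 * a 2)
    {d : ℕ} (hd : 2 ≤ d) : ¬ (jensenPoly a d 0).Splits := by
  obtain ⟨d, rfl⟩ := Nat.exists_eq_add_of_le' hd
  exact fun h ↦ absurd hlt (not_lt.mpr (mul_le_sq_of_splits_jensenPoly ha h))

/-! ## The witness `G(w) = cosh 2 + cosh √w` -/

/-- The witness `coshSqrtShift w = cosh 2 + coshSqrt w = cosh 2 + cosh √w`. [folklore] -/
def coshSqrtShift (w : ℂ) : ℂ := (Real.cosh 2 : ℂ) + coshSqrt w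

/-- `cosh 2 > 2` (indeed `cosh 2 ≥ (1 + 2 + 2)/2 = 5/2`). [folklore] -/
theorem two_lt_cosh_two : (2 : ℝ) < Real.cosh 2 := by
  rw [Real.cosh_eq]
  have h1 : (5 : ℝ) ≤ Real.exp 2 := by
    have := Real.quadratic_le_exp_of_nonneg (show (0 : ℝ) ≤ 2 by norm_num)
    linarith
  have h2 : 0 < Real.exp (-2) := Real.exp_pos _
  linarith

/-- `G` is entire. [folklore] -/
theorem differentiable_coshSqrtShift : Differentiable ℂ coshSqrtShift :=
  (differentiable_const _).add differentiable_coshSqrt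

/-- `G' = coshSqrt'`. [folklore] -/
theorem deriv_coshSqrtShift : deriv coshSqrtShift = deriv coshSqrt := by
  funext w
  rw [show coshSqrtShift = fun v ↦ (Real.cosh 2 : ℂ) + coshSqrt v from rfl, deriv_const_add]

/-- `G` is entire of order `< 1` (`‖G w‖ ≤ (cosh 2 + 1) exp (‖w‖^{1/2})`). [folklore] -/
theorem isEntireOfOrderLtOne_coshSqrtShift : IsEntireOfOrderLtOne coshSqrtShift := by
  refine ⟨differentiable_coshSqrtShift, 1 / 2, Real.cosh 2 + 1, by norm_num, fun z ↦ ?_⟩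
  have h1 := norm_coshSqrt_le z
  have h2 : 1 ≤ Real.exp (‖z‖ ^ (1 / 2 : ℝ)) := Real.one_le_exp (by positivity)
  have h3 : ‖((Real.cosh 2 : ℝ) : ℂ)‖ = Real.cosh 2 := by
    rw [Complex.norm_real, Real.norm_eq_abs, abs_of_pos (Real.cosh_pos _)]
  calc ‖coshSqrtShift z‖ ≤ ‖((Real.cosh 2 : ℝ) : ℂ)‖ + ‖coshSqrt z‖ := norm_add_le _ _
    _ ≤ Real.cosh 2 + Real.exp (‖z‖ ^ (1 / 2 : ℝ)) := by rw [h3]; gcongr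
    _ ≤ (Real.cosh 2 + 1) * Real.exp (‖z‖ ^ (1 / 2 : ℝ)) := by
        nlinarith [Real.cosh_pos (2 : ℝ)]

/-- Taylor coefficients of `G`: `G(0) = cosh 2 + 1`. [folklore] -/
theorem iteratedDeriv_coshSqrtShift_zero_zero :
    iteratedDeriv 0 coshSqrtShift 0 = ((Real.cosh 2 + 1 : ℝ) : ℂ) := by
  rw [iteratedDeriv_zero, coshSqrtShift, coshSqrt_zero]
  push_cast
  ring

/-- Taylor coefficients of `G`: `G⁽ᵏ⁾(0) = k!/(2k)!` for `k ≥ 1`. [folklore] -/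
theorem iteratedDeriv_coshSqrtShift_zero_of_pos {k : ℕ} (hk : 0 < k) :
    iteratedDeriv k coshSqrtShift 0 = (((k ! : ℝ) / ((2 * k)! : ℕ) : ℝ) : ℂ) := by
  rw [show coshSqrtShift = fun w ↦ (Real.cosh 2 : ℂ) + coshSqrt w from rfl,
    iteratedDeriv_const_add hk, iteratedDeriv_coshSqrt_zero, div_eq_mul_inv]
  push_cast
  ring

/-- The Taylor sequence of `G` in the base file's normalisation `taylorCoeffSeq G k = Re G⁽ᵏ⁾(0)`:
`cosh 2 + 1, 1/2!, 2!/4!, 3!/6!, …`. [folklore] -/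
theorem taylorCoeffSeq_coshSqrtShift (k : ℕ) :
    taylorCoeffSeq coshSqrtShift k = if k = 0 then Real.cosh 2 + 1 else (k ! : ℝ) / ((2 * k)! : ℕ) := by
  rw [taylorCoeffSeq]
  split_ifs with hk
  · rw [hk, iteratedDeriv_coshSqrtShift_zero_zero, Complex.ofReal_re]
  · rw [iteratedDeriv_coshSqrtShift_zero_of_pos (Nat.pos_of_ne_zero hk), Complex.ofReal_re]

/-- All Taylor coefficients of `G` are real … [folklore] -/
theorem im_iteratedDeriv_coshSqrtShift (k : ℕ) : (iteratedDeriv k coshSqrtShift 0).im = 0 := by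
  rcases Nat.eq_zero_or_pos k with rfl | hk
  · rw [iteratedDeriv_coshSqrtShift_zero_zero, Complex.ofReal_im]
  · rw [iteratedDeriv_coshSqrtShift_zero_of_pos hk, Complex.ofReal_im]

/-- … and positive (as `γ(n) > 0` for `Ξ`). [folklore] -/
theorem taylorCoeffSeq_coshSqrtShift_pos (k : ℕ) : 0 < taylorCoeffSeq coshSqrtShift k := by
  rw [taylorCoeffSeq_coshSqrtShift]
  split_ifs
  · positivity
  · positivity

/-! ### The zeros of `G`: `w = (±2 + (2m+1)πi)²` — none real, all on the image of the two vertical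
lines `Re u = ±2`, infinitely many -/

/-- Structure of the zeros: if `G w = 0` then `w = u²` with `Re u = ±2` and `Im u` an odd multiple
of `π` (solve `cosh u = -cosh 2 = cosh (2 + πi)`). [folklore] -/
theorem coshSqrtShift_eq_zero {w : ℂ} (hw : coshSqrtShift w = 0) :
    ∃ u : ℂ, u ^ 2 = w ∧ (u.re = 2 ∨ u.re = -2) ∧ ∃ m : ℤ, u.im = (2 * m + 1) * Real.pi := by
  obtain ⟨u, rfl⟩ := exists_sq_eq w
  refine ⟨u, rfl, ?_⟩
  have hcosh : Complex.cosh u = -Complex.cosh 2 := by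
    rw [coshSqrtShift, coshSqrt_sq, Complex.ofReal_cosh] at hw
    push_cast at hw
    linear_combination hw
  have hcos : Complex.cos (2 * I + Real.pi) = Complex.cos (u * I) := by
    rw [Complex.cos_add_pi, Complex.cos_mul_I, Complex.cos_mul_I, hcosh]
  obtain ⟨k, hk | hk⟩ := Complex.cos_eq_cos_iff.1 hcos
  · have hu : u = 2 - (2 * k + 1) * Real.pi * I := by
      have : u = u * I * (-I) := by rw [mul_assoc, mul_neg, I_mul_I, neg_neg, mul_one]
      rw [this, hk]
      ring_nf
      rw [I_sq]
      ring
    refine ⟨Or.inl ?_, -(k + 1), ?_⟩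
    · rw [hu]; simp
    · rw [hu]; push_cast; simp; ring
  · have hu : u = -2 + (1 - 2 * k) * Real.pi * I := by
      have : u = u * I * (-I) := by rw [mul_assoc, mul_neg, I_mul_I, neg_neg, mul_one]
      rw [this, hk]
      ring_nf
      rw [I_sq]
      ring
    refine ⟨Or.inr ?_, -k, ?_⟩
    · rw [hu]; simp
    · rw [hu]; push_cast; simp; ring

/-- **No zero of `G` is real** (`Im (u²) = 2 Re u Im u = ±4(2m+1)π ≠ 0`): the analogue of RH fails
for every single zero. [folklore] -/
theorem im_ne_zero_of_coshSqrtShift_eq_zero {w : ℂ} (hw : coshSqrtShift w = 0) : w.im ≠ 0 := by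
  obtain ⟨u, rfl, hre, m, him⟩ := coshSqrtShift_eq_zero hw
  have hodd : ((2 * m + 1 : ℤ) : ℝ) ≠ 0 := by exact_mod_cast (by omega : (2 * m + 1 : ℤ) ≠ 0)
  push_cast at hodd
  have h2 : (u ^ 2).im = 2 * u.re * u.im := by simp [sq]; ring
  rw [h2, him]
  rcases hre with h | h <;> rw [h] <;> simp [hodd, Real.pi_ne_zero]

/-- Every zero of `G` is the square of a point on one of the two vertical lines `Re u = ±2`
(the analogue, for `G`, of "every zero `(ρ - ½)²` of `Ξ(√z)` has `|Re (ρ - ½)| < ½`" — but with the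
zeros ON two lines off the axis instead of near it). [folklore] -/
theorem abs_re_eq_two_of_coshSqrtShift_eq_zero {w : ℂ} (hw : coshSqrtShift w = 0) :
    ∃ u : ℂ, u ^ 2 = w ∧ |u.re| = 2 := by
  obtain ⟨u, rfl, hre, -⟩ := coshSqrtShift_eq_zero hw
  refine ⟨u, rfl, ?_⟩
  rcases hre with h | h <;> rw [h] <;> norm_num

/-- The explicit zeros `w_k = (2 + (2k+1)πi)²`, `k ∈ ℕ`. [folklore] -/
theorem coshSqrtShift_zeroSeq (k : ℕ) :
    coshSqrtShift ((2 + (2 * k + 1) * Real.pi * I) ^ 2) = 0 := by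
  rw [coshSqrtShift, coshSqrt_sq, Complex.ofReal_cosh]
  induction k with
  | zero =>
    have : (2 + (2 * ((0 : ℕ) : ℂ) + 1) * Real.pi * I) = 2 + Real.pi * I := by push_cast; ring
    rw [this, Complex.cosh_add_pi_mul_I]
    push_cast
    ring
  | succ k ih =>
    have : (2 + (2 * ((k + 1 : ℕ) : ℂ) + 1) * Real.pi * I) =
        (2 + (2 * (k : ℂ) + 1) * Real.pi * I) + Real.pi * I + Real.pi * I := by
      push_cast; ring
    rw [this, Complex.cosh_add_pi_mul_I, Complex.cosh_add_pi_mul_I, neg_neg]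
    exact ih

/-- `G` has a zero, e.g. `(2 + πi)²`. [folklore] -/
theorem coshSqrtShift_sq_two_add_pi_mul_I : coshSqrtShift ((2 + Real.pi * I) ^ 2) = 0 := by
  simpa using coshSqrtShift_zeroSeq 0

/-- **`G` has infinitely many zeros** (the `w_k` have distinct imaginary parts `4(2k+1)π`). [folklore] -/
theorem coshSqrtShift_zeros_infinite : {w : ℂ | coshSqrtShift w = 0}.Infinite := by
  have him : ∀ k : ℕ, (((2 + (2 * k + 1) * Real.pi * I) ^ 2 : ℂ)).im = 4 * (2 * k + 1) * Real.pi := by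
    intro k
    simp [sq]
    ring
  refine Set.infinite_of_injective_forall_mem (f := fun k : ℕ ↦ (2 + (2 * k + 1) * Real.pi * I) ^ 2)
    (fun j k hjk ↦ ?_) coshSqrtShift_zeroSeq
  have h := congrArg Complex.im hjk
  simp only [him] at h
  have hπ : Real.pi ≠ 0 := Real.pi_ne_zero
  have : (j : ℝ) = k := by
    have h' : (4 * (2 * (j : ℝ) + 1) - 4 * (2 * k + 1)) * Real.pi = 0 := by linear_combination h
    rcases mul_eq_zero.1 h' with h1 | h1
    · linarith
    · exact absurd h1 hπ
  exact_mod_cast this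

/-! ### The Jensen polynomials of `G` -/

/-- **Every `J^{d,n}` of `G` with shift `n ≥ 1` is hyperbolic**: for `n ≥ 1` these are the Jensen
polynomials of the Taylor sequence of `G' = coshSqrt'`, a genus-zero Laguerre–Pólya function
(`splits_jensenPoly_deriv_coshSqrt`). [cite: CravenCsordas1989, §1 (i)] -/
theorem splits_jensenPoly_coshSqrtShift {n : ℕ} (hn : 1 ≤ n) (d : ℕ) :
    (jensenPoly (taylorCoeffSeq coshSqrtShift) d n).Splits := by
  obtain ⟨m, rfl⟩ := Nat.exists_eq_add_of_le' hn
  have key : jensenPoly (taylorCoeffSeq coshSqrtShift) d (m + 1) =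
      jensenPoly (fun k ↦ (iteratedDeriv k (deriv coshSqrt) 0).re) d m := by
    ext j
    rw [coeff_jensenPoly, coeff_jensenPoly, iteratedDeriv_deriv_coshSqrt_zero, taylorCoeffSeq,
      show m + 1 + j = m + j + 1 by ring,
      iteratedDeriv_coshSqrtShift_zero_of_pos (Nat.succ_pos _), iteratedDeriv_coshSqrt_zero,
      div_eq_mul_inv]
    push_cast
    rfl
  rw [key]
  exact splits_jensenPoly_deriv_coshSqrt d m

/-- **No `J^{d,0}` of `G` with `d ≥ 2` is hyperbolic**: Newton's inequality fails at the constant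
term, `a₁² = 1/4 < (cosh 2 + 1)/12 = a₀ a₂` because `cosh 2 > 2`. [folklore] -/
theorem not_splits_jensenPoly_coshSqrtShift_zero {d : ℕ} (hd : 2 ≤ d) :
    ¬ (jensenPoly (taylorCoeffSeq coshSqrtShift) d 0).Splits := by
  refine not_splits_jensenPoly_of_sq_lt (taylorCoeffSeq_coshSqrtShift_pos 0).ne' ?_ hd
  rw [taylorCoeffSeq_coshSqrtShift, taylorCoeffSeq_coshSqrtShift, taylorCoeffSeq_coshSqrtShift]
  simp only [if_true, one_ne_zero, if_false, OfNat.ofNat_ne_zero]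
  norm_num [Nat.factorial]
  linarith [two_lt_cosh_two]

/-- In the base file's vocabulary: the Taylor sequence of `G` is `EventuallyHyperbolic` (uniformly,
`N(d) = 1`) but not `AllHyperbolic`. [folklore] -/
theorem eventuallyHyperbolic_coshSqrtShift : EventuallyHyperbolic (taylorCoeffSeq coshSqrtShift) :=
  fun d _ ↦ ⟨1, fun _ hn ↦ splits_jensenPoly_coshSqrtShift hn d⟩

/-- … but not `AllHyperbolic`: `J^{2,0}` already fails. [folklore] -/
theorem not_allHyperbolic_coshSqrtShift : ¬ AllHyperbolic (taylorCoeffSeq coshSqrtShift) :=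
  fun h ↦ not_splits_jensenPoly_coshSqrtShift_zero le_rfl (h 2 0)

/-! ## The barrier in the `Ξ(√z)` normalisation -/

/-- **Barrier `JensenPolynomialsSqrt` (Farmer 2022 §§3–4, in the normalisation of Pólya's criterion
and of GORZ 2019).** In the tree, RH is `∀ w, G w = 0 → Im w = 0` for the genus-zero function
`G = Literature.NumberTheory.LFunctions.xiSq` (`G(w²) = ξ(½ + w)`, order `≤ 7/8`;
`riemannHypothesis_iff_forall_xiSq_eq_zero_im_eq_zero`), the GORZ coefficients are
`γ(k) = 8 Re G⁽ᵏ⁾(0)` (`taylorCoeffSeq_xiSq`), Pólya's criterion is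
`RH ↔ AllHyperbolic (taylorCoeffSeq G)` and GORZ Thm. 1 is `EventuallyHyperbolic (taylorCoeffSeq G)`
(`allHyperbolic_taylorCoeffSeq_xiSq_iff`, `eventuallyHyperbolic_taylorCoeffSeq_xiSq_iff`). The
statement: there is an entire `G` of order `< 1` sharing every structural property of `xiSq` that the
tree knows unconditionally — real and positive Taylor coefficients, all zeros squares `u²` of points
of a fixed vertical strip (here: of the two lines `|Re u| = 2`), `J^{d,n}` hyperbolic for every `d`
and all large `n` — and moreover the strongest conceivable large-shift statement: `G'` is itself of
order `< 1` with only real zeros (genus-zero Laguerre–Pólya), so that `J^{d,n}` is hyperbolic for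
EVERY `d` and EVERY `n ≥ 1`; and yet NOT ONE zero of `G` is real (there are infinitely many), and
`J^{d,0}` is non-hyperbolic for every `d ≥ 2`. Proved below (`JensenPolynomialsSqrt_holds`) with
`G(w) = cosh 2 + cosh √w` (`coshSqrtShift`). Note that the `J^{d,n}`, `n ≥ 1`, do not involve the
coefficient `Re G(0)` at all, while for `G_C = C + cosh √w` (`C` real) that coefficient alone decides:
all zeros of `G_C` are real iff `-1 ≤ C ≤ 1`, and no zero is real once `C > 1`.

BARRIER (structured block, D-0021):
- technique_class: as `JensenPolynomials`, transported to the even / `√`-normalisation `J^{d,n}_γ = J^{d,n}_{Ξ(√·),cl}` in which Pólya's criterion (`Literature.NumberTheory.LFunctions.polya_jensen_holds`) and GORZ Thms. 1–3 are stated: inferences from hyperbolicity of `J^{d,n}_γ` for `n ≥ 1` (large or all such shifts; Turán / higher Turán / Laguerre-type inequalities in the shift aspect, all consequences of `G⁽ⁿ⁾` being in the Laguerre–Pólya class) together with the unconditional structure of `G = xiSq` (order `< 1`, `γ(n) > 0`, zeros `(ρ-½)²` with `|Re(ρ-½)| < ½`, GORZ Thm. 1) [cite: Farmer2022, §3 and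 §4] [cite: GORZPNAS2019, §1]
- blocks: RiemannHypothesis via `polya_jensen` / `riemannHypothesis_iff_forall_xiSq_eq_zero_im_eq_zero` reached from shift-`≥ 1` information: the witness satisfies all of the above with `J^{d,n}` hyperbolic for all `d` and all `n ≥ 1`, has no real zero, and fails `J^{d,0}` for every `d ≥ 2` (this theorem) [cite: Farmer2022, §4]
- because: "the even Jensen polynomial of `f(z)` is the classical Jensen polynomial of `f(√z)`" [cite: Farmer2022, §3]; for `f = X_{10}` (here: `f(z) = cos z + cosh 2`, `f(√-w) = G(w)`) "all zeros of the first derivative are real, therefore … `J^{d,n}_{X_{10},cl}` has only real zeros for all `n ≥ 1`, as does the even Jensen polynomial `J^{d,n}_{X_{10},ev}` for all even `n ≥ 2`" (in fact for all `n ≥ 1`: `(f∘√)' = f'(√w)/(2√w)` has only real zeros when `f'` has) [cite: Farmer2022, §4]; genus-zero Laguerre–Pólya functions have hyperbolic Jensen polynomials (`PolyaSchur.splits_jensenPoly_taylor_of_zeros_real`) [cite: CravenCsordas1989, §1 (i)]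
- evasions_known: none published (searched 2026-08-16): the effective and widened large-shift regions `n ≥ c e^{d/2}` [cite: GriffinEtAl2022, Thm. 1.1] and `n³ log²(n+2) ≥ K d⁵` [cite: Holland2026, Thm. 1.1], and the range `d ≤ 9.36·10^20`, all `n ≥ 0`, from a numerical verification of RH [cite: GriffinEtAl2022, Cor. 1.3], all have the blocked shape `{n ≥ N(d)}` with `N(d) ≥ 1`, resp. finitely many `d`; O'Sullivan's Hermite-twisted `P^{d,n}` are hyperbolic as soon as the `J^{d,n}` are [cite: Osullivan2021] [cite: Farmer2022, §4.1]; Durán's Brenke-polynomial criteria are, like Pólya's, real-rootedness criteria over all degrees (`𝓡_B = L–P`), not large-shift statements [cite: Duran2024, abstract]; so any route must use the shift-`0` polynomials `J^{d,0}_γ` for unboundedly many `d` (equivalently `γ(0) = 8ξ(½)` together with all of `γ`), or information on `Ξ` finer than the structural list above [cite: Farmer2022, §4]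
- status: established (proved here)
- scope_caveats: says nothing against proving `J^{d,0}_γ` hyperbolic for all `d` by other means (that IS RH); the witness has no real zeros at all — a witness with infinitely many real AND infinitely many non-real zeros in a strip and `f' ∈ L–P` (e.g. `f(z) = cos z + 2 cos (z/20)`, on paper, by Rouché for `f'`) is not formalised; Chasse-type shift-`0` statements (`JensenPolynomialsChasse.lean`) are quantitative, not no-go theorems [cite: Farmer2022, §4]

[cite: Farmer2022, §3 and §4] -/
def JensenPolynomialsSqrt : Prop :=
  ∃ G : ℂ → ℂ, IsEntireOfOrderLtOne G ∧
    (∀ k : ℕ, (iteratedDeriv k G 0).im = 0 ∧ 0 < (iteratedDeriv k G 0).re) ∧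
    IsEntireOfOrderLtOne (deriv G) ∧ (∀ w : ℂ, deriv G w = 0 → w.im = 0) ∧
    (∃ a : ℝ, ∀ w : ℂ, G w = 0 → ∃ u : ℂ, u ^ 2 = w ∧ |u.re| = a) ∧
    {w : ℂ | G w = 0}.Infinite ∧ (∀ w : ℂ, G w = 0 → w.im ≠ 0) ∧
    (∀ d n : ℕ, 1 ≤ n → (jensenPoly (taylorCoeffSeq G) d n).Splits) ∧
    (∀ d : ℕ, 2 ≤ d → ¬ (jensenPoly (taylorCoeffSeq G) d 0).Splits)

/-- **The barrier `JensenPolynomialsSqrt` holds**, witnessed by `G(w) = cosh 2 + cosh √w`.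
[cite: Farmer2022, §3 and §4] -/
theorem JensenPolynomialsSqrt_holds : JensenPolynomialsSqrt := by
  refine ⟨coshSqrtShift, isEntireOfOrderLtOne_coshSqrtShift, fun k ↦ ⟨im_iteratedDeriv_coshSqrtShift k,
    taylorCoeffSeq_coshSqrtShift_pos k⟩, ?_, ?_, ⟨2, fun w hw ↦ abs_re_eq_two_of_coshSqrtShift_eq_zero hw⟩,
    coshSqrtShift_zeros_infinite, fun w hw ↦ im_ne_zero_of_coshSqrtShift_eq_zero hw,
    fun d n hn ↦ splits_jensenPoly_coshSqrtShift hn d,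
    fun d hd ↦ not_splits_jensenPoly_coshSqrtShift_zero hd⟩
  · rw [deriv_coshSqrtShift]; exact isEntireOfOrderLtOne_deriv_coshSqrt
  · rw [deriv_coshSqrtShift]; exact fun w hw ↦ im_eq_zero_of_deriv_coshSqrt_eq_zero hw

/-- Corollary (the `√`-normalised form of `not_allHyperbolic_of_eventuallyHyperbolic`): even for
entire functions of order `< 1` with positive Taylor coefficients whose zeros are squares of points of
a vertical strip — the class of `xiSq` — `EventuallyHyperbolic` does not imply `AllHyperbolic`, nor
the reality of a single zero. [cite: Farmer2022, §4] -/
theorem not_allHyperbolic_of_eventuallyHyperbolic_sqrt :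
    ¬ ∀ G : ℂ → ℂ, IsEntireOfOrderLtOne G → (∀ k : ℕ, 0 < taylorCoeffSeq G k) →
        (∃ a : ℝ, ∀ w : ℂ, G w = 0 → ∃ u : ℂ, u ^ 2 = w ∧ |u.re| ≤ a) →
        EventuallyHyperbolic (taylorCoeffSeq G) → AllHyperbolic (taylorCoeffSeq G) := by
  intro h
  refine not_allHyperbolic_coshSqrtShift (h coshSqrtShift isEntireOfOrderLtOne_coshSqrtShift
    taylorCoeffSeq_coshSqrtShift_pos ⟨2, fun w hw ↦ ?_⟩ eventuallyHyperbolic_coshSqrtShift)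
  obtain ⟨u, hu, h2⟩ := abs_re_eq_two_of_coshSqrtShift_eq_zero hw
  exact ⟨u, hu, h2.le⟩

/-! ## The same data for `G = xiSq` (`G(w²) = ξ(½ + w)`): what the barrier is about -/

/-- The base file's Taylor sequence of `xiSq` is `γ/8`. [cite: GORZPNAS2019, eq. (1)] -/
theorem taylorCoeffSeq_xiSq : taylorCoeffSeq xiSq = fun k ↦ 8⁻¹ * xiTaylorCoeff k :=
  funext re_iteratedDeriv_xiSq

/-- Pólya's criterion lives on `taylorCoeffSeq xiSq`: `AllHyperbolic (taylorCoeffSeq xiSq)` is the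
tree's `JensenPolyaCriterion` (the factor `8⁻¹` does not affect hyperbolicity). [cite: GORZPNAS2019, §1] -/
theorem splits_jensenPoly_taylorCoeffSeq_xiSq_iff (d n : ℕ) :
    (jensenPoly (taylorCoeffSeq xiSq) d n).Splits ↔ (jensenPoly xiTaylorCoeff d n).Splits := by
  rw [taylorCoeffSeq_xiSq, Literature.Analysis.Complex.PolyaSchur.jensenPoly_const_mul]
  refine ⟨fun h ↦ ?_, fun h ↦ h.C_mul _⟩
  have h' := h.C_mul 8
  rwa [← mul_assoc, ← C_mul, mul_inv_cancel₀ (by norm_num : (8 : ℝ) ≠ 0), C_1, one_mul] at h'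

/-- `AllHyperbolic (taylorCoeffSeq xiSq)` is the tree's `JensenPolyaCriterion`. [cite: GORZPNAS2019, §1] -/
theorem allHyperbolic_taylorCoeffSeq_xiSq_iff :
    AllHyperbolic (taylorCoeffSeq xiSq) ↔ Literature.NumberTheory.LFunctions.JensenPolyaCriterion :=
  forall₂_congr fun d n ↦ splits_jensenPoly_taylorCoeffSeq_xiSq_iff d n

/-- `EventuallyHyperbolic (taylorCoeffSeq xiSq)` is the tree's `gorz_eventually` (GORZ Thm. 1).
[cite: GORZPNAS2019, Thm. 1] -/
theorem eventuallyHyperbolic_taylorCoeffSeq_xiSq_iff :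
    EventuallyHyperbolic (taylorCoeffSeq xiSq) ↔ Literature.NumberTheory.LFunctions.gorz_eventually := by
  refine forall₂_congr fun d _ ↦ exists_congr fun N ↦ forall₂_congr fun n _ ↦ ?_
  exact splits_jensenPoly_taylorCoeffSeq_xiSq_iff d n

/-- **`xiSq` satisfies every hypothesis of the witness class, unconditionally**: order `< 1`
(`isEntireOfOrderLtOne_xiSq`), real and positive Taylor coefficients (`im_iteratedDeriv_xiSq`,
`xiTaylorCoeff_pos_holds`), every zero is `(ρ - ½)²` with `|Re (ρ - ½)| < ½`
(`exists_zero_of_xiSq_eq_zero`), and `EventuallyHyperbolic` (GORZ Thm. 1, `gorz_eventually_holds`);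
while RH is exactly the reality of its zeros and Pólya's criterion exactly `AllHyperbolic`.
[cite: GORZPNAS2019, Thm. 1] -/
theorem xiSq_mem_witnessClass :
    IsEntireOfOrderLtOne xiSq ∧
    (∀ k : ℕ, (iteratedDeriv k xiSq 0).im = 0 ∧ 0 < (iteratedDeriv k xiSq 0).re) ∧
    (∀ w : ℂ, xiSq w = 0 → ∃ u : ℂ, u ^ 2 = w ∧ |u.re| < 1 / 2) ∧
    EventuallyHyperbolic (taylorCoeffSeq xiSq) ∧
    (RiemannHypothesis ↔ ∀ w : ℂ, xiSq w = 0 → w.im = 0) ∧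
    (RiemannHypothesis ↔ AllHyperbolic (taylorCoeffSeq xiSq)) := by
  refine ⟨Literature.NumberTheory.LFunctions.isEntireOfOrderLtOne_xiSq, fun k ↦ ⟨
    Literature.NumberTheory.LFunctions.im_iteratedDeriv_xiSq k, ?_⟩, fun w hw ↦ ?_,
    eventuallyHyperbolic_taylorCoeffSeq_xiSq_iff.2 Literature.NumberTheory.LFunctions.gorz_eventually_holds,
    Literature.NumberTheory.LFunctions.riemannHypothesis_iff_forall_xiSq_eq_zero_im_eq_zero, ?_⟩
  · have := re_iteratedDeriv_xiSq k
    rw [this]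
    exact mul_pos (by norm_num) (Literature.NumberTheory.LFunctions.xiTaylorCoeff_pos_holds k)
  · obtain ⟨ρ, -, h0, h1, hρ⟩ := exists_zero_of_xiSq_eq_zero hw
    refine ⟨ρ - 1 / 2, hρ, ?_⟩
    rw [abs_lt]
    constructor
    · simp; linarith
    · simp; linarith
  · rw [allHyperbolic_taylorCoeffSeq_xiSq_iff]
    exact Literature.NumberTheory.LFunctions.polya_jensen_holds

end Literature.Barriers.RiemannHypothesis

end
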